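import Summits.SmoothPoincare4.SmoothPoincare4.Theses.EntropyRung
import Summits.SmoothPoincare4.SmoothPoincare4.Theorems.EntropyRungSubcylindricalRecognitionOfBamler
import Summits.SmoothPoincare4.SmoothPoincare4.Theorems.EntropyRungSubcylindricalRecognitionCompactModelRecognition
import Literature.Geometry.Riemannian.BamlerTangentFlowAtInfinity
import Literature.Geometry.Riemannian.BamlerEpsilonRegularity
import Literature.Geometry.Riemannian.BamlerFCompactness
import Literature.Geometry.Riemannian.BamlerFCompactnessAssembly
import Literature.Topology.FourManifolds.HomotopyS4CompactProofs
import HarnessLib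
import HarnessLib.Audit

/-!
# Line `shrinker-emergence` — crux `EntropyRung.SubcylindricalRecognition` (stmt-SmoothPoincare4-10869) THROUGH its
decomposition leaf `EntropyRung.ShrinkerEmerges` (stmt-SmoothPoincare4-17634)

Crux-strategist r1 (planner-cstrat-stmt-SmoothPoincare4-10869-r1-0, 2026-08-17). This skeleton is the PLAN OF THE LEAF of
the r1 decomposition `RUNG ⇐ ShrinkerEmerges ∧ NoncompactShrinkerGap ∧ CompactShrinkerGap` (glue item
`RecognitionOfEmergence`, stmt-SmoothPoincare4-18300, proved in Theorems/EntropyRungRecognitionOfEmergence.lean):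
it is the live line `ancient-sphere-rigidity` r10 (lead c7) RE-TARGETED through the leaf — the SAME four registered
Bamler milestone stubs (verbatim, so they deduplicate with the lead's registrations and every brick the leads land
serves both), composed first into the named fact N1 `bamler_orbifoldTangentFlowAtInfinity_four`, then into the leaf
`ShrinkerEmerges` (4 lines over the landed fact-free blow-up chain), then — with the sibling cruxes #2, #4 — into RUNG by
the decomposition glue. No new mathematics relative to r10 is claimed; what is new is the SEAM: the Bamler content now
closes an SPC4-free item of its own (`ShrinkerEmerges_of`), and RUNG is derived.

Stubs (the only `sorry`s): `stub_epsilonRegularity` (2020a Thm 10.2, typed fact), `stub_totalBoundedness` +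
`stub_completeness` (2023 §7.3 / §5.4, the two halves of 𝔽-compactness; `stub_FCompactness` DERIVED by the landed
assembly p162151), `stub_structureExport` (2020b §6, §8–9 + 2020c Thms 2.4/2.9/2.16/2.40/2.46: the two facts ⇒ N1).
Hardest stub: `stub_structureExport` (≈ 150 pp.; needs the regular/singular decomposition, metric solitons, Nash entropy
of metric flow pairs, Cheeger–Gromov convergence of pointed flows — N1-STATUS.md D2/D7).
-/

noncomputable section

-- the registered namespace repeats a component
set_option linter.dupNamespace false

open scoped Manifold ContDiff Topology ENNReal NNReal ContinuousMap
open Set MeasureTheory Filter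
open Literature.Geometry.Lorentzian Literature.Geometry.Riemannian

namespace Summit.SmoothPoincare4.SmoothPoincare4.Cruxes.SubcylindricalRecognition.ShrinkerEmergence

/-! ## The four registered milestone stubs (verbatim those of `Lines/ancient_sphere_rigidity.lean` r10) -/

/-- **Stub 2a** — Bamler 2020a Thm 10.2 (ε-regularity), the typed named fact `bamler_epsilonRegularity`.
[cite: Bamler2020Entropy, §10.1 Thm 10.2] -/
theorem stub_epsilonRegularity : bamler_epsilonRegularity := by
  sorry

/-- **Stub 2b-TB** — total boundedness half of Bamler 2023 Thm 7.4 (§7.3), `J = ∅`. Verbatim the first hypothesis of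
`bamler_FCompactness_ricciFlow_of_totallyBounded_of_complete` (BamlerFCompactnessAssembly.lean, p162151).
[cite: Bamler2023, §7.3, proof of Thm 7.4] -/
theorem stub_totalBoundedness :
    ∀ (H C a T : ℝ), 0 ≤ H → a < T → ∀ P : ℕ → MetricFlowPair.{0} (Set.Icc a T),
      (∀ n, (P n).flow.IsHConcentrated H) → (∀ n, Set.Ioo a T ⊆ (P n).I') →
      (∀ n (t : (P n).I'), variance ((P n).μ t) ((P n).μ t) ≤ ENNReal.ofReal C) →
      ∀ ε : ℝ≥0∞, 0 < ε → ∃ φ : ℕ → ℕ, StrictMono φ ∧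
        ∀ i j, MetricFlowPair.fDist ∅ (P (φ i)) (P (φ j)) ≤ ε := by
  sorry

/-- **Stub 2b-CP** — completeness (Bamler 2023 §5.4 Thm 5.19 with the closedness of `H`-concentration), `J = ∅`.
Verbatim the second hypothesis of `bamler_FCompactness_ricciFlow_of_totallyBounded_of_complete`.
[cite: Bamler2023, §5.4, Thm 5.19, Lemma 5.20] -/
theorem stub_completeness :
    ∀ (H a T : ℝ), 0 ≤ H → a < T → ∀ P : ℕ → MetricFlowPair.{0} (Set.Icc a T),
      (∀ n, (P n).flow.IsHConcentrated H) → (∀ n, MeasurableSet (Set.Icc a T \ (P n).I')) →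
      (∀ n, MetricFlowPair.fDist ∅ (P n) (P (n + 1)) < 2⁻¹ ^ n) →
      ∃ Pinf : MetricFlowPair.{0} (Set.Icc a T), Pinf.flow.IsHConcentrated H ∧
        MeasurableSet (Set.Icc a T \ Pinf.I') ∧
        Tendsto (fun n ↦ MetricFlowPair.fDist ∅ (P n) Pinf) atTop (𝓝 0) := by
  sorry

/-- **Stub 2b, DERIVED** — `bamler_FCompactness_ricciFlow` from stubs 2b-TB and 2b-CP by the landed assembly (p162151).
[cite: Bamler2023, §7.1 Cor 7.5; §7.3 proof of Thm 7.4] -/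
theorem stub_FCompactness : bamler_FCompactness_ricciFlow :=
  bamler_FCompactness_ricciFlow_of_totallyBounded_of_complete stub_totalBoundedness stub_completeness

/-- **Stub 2c** — the structure-theory export: Bamler 2020b §6, §8–9 and 2020c Thms 2.4, 2.9, 2.16, 2.40, 2.46 (n = 4),
reading off (E1)–(E7) of N1 from an 𝔽-limit (stub 2b) whose flatness alternative is excluded by ε-regularity (stub 2a).
[cite: Bamler2020Structure, Thm 4, 9, 15, 29, 35] [cite: Bamler2023, §6, §9] -/
theorem stub_structureExport :
    bamler_epsilonRegularity → bamler_FCompactness_ricciFlow → bamler_orbifoldTangentFlowAtInfinity_four := by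
  sorry

/-! ## Compositions (no `sorry` below this line) -/

/-- N1 from the stubs. [cite: Bamler2020Structure, Thm 4, 9, 15, 29, 35] -/
theorem bamlerFact_of_stubs : bamler_orbifoldTangentFlowAtInfinity_four :=
  stub_structureExport stub_epsilonRegularity stub_FCompactness

/-- **N1 → the leaf**: `ShrinkerEmerges` is the route-vocabulary shadow of N1 — the landed fact-free blow-up chain
`RecognitionOfShrinkerGaps.blowupSequence` followed by the landed blow-down `RecognitionOfShrinkerGaps.blowdown_of`.
[cite: Bamler2020Structure, §2.7 Thm 2.40; §2.10 Thm 2.46] [cite: Perelman2002, §4, Thm. 4.1] -/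
theorem shrinkerEmerges_of_bamler (hN1 : bamler_orbifoldTangentFlowAtInfinity_four) :
    _root_.Summit.SmoothPoincare4.SmoothPoincare4.Theses.EntropyRung.ShrinkerEmerges := by
  intro M _ _ _ _ _ _ _ _ _ _ g _ hg hR hν
  obtain ⟨κ, δ', c, _hκ, hδ', hc, A, gk, covk, xk, hA, hflow, hRiem, hcurv, hpt, _hnc, hfloor⟩ :=
    _root_.Summit.SmoothPoincare4.SmoothPoincare4.Theorems.RecognitionOfShrinkerGaps.blowupSequence M g hg hR hν
  exact _root_.Summit.SmoothPoincare4.SmoothPoincare4.Theorems.RecognitionOfShrinkerGaps.blowdown_of hN1 M A gk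
    covk xk δ' c hδ' hc hA hflow hRiem hcurv hpt hfloor

/-- **The leaf from the stubs** — `ShrinkerEmerges` (stmt-SmoothPoincare4-17634) modulo the four Bamler milestones.
[cite: Bamler2020Structure, §2.7 Thm 2.40] -/
theorem ShrinkerEmerges_of :
    _root_.Summit.SmoothPoincare4.SmoothPoincare4.Theses.EntropyRung.ShrinkerEmerges :=
  shrinkerEmerges_of_bamler bamlerFact_of_stubs

/-- **The decomposition glue** (= Theorems/EntropyRungRecognitionOfEmergence.lean, repeated here so that the skeleton is
self-contained): `ShrinkerEmerges → NoncompactShrinkerGap → CompactShrinkerGap → SubcylindricalRecognition`.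
[cite: LeeSmoothManifolds2013, Thm. 4.29] -/
theorem subcylindricalRecognition_of_leaves
    (hE : _root_.Summit.SmoothPoincare4.SmoothPoincare4.Theses.EntropyRung.ShrinkerEmerges)
    (h₂ : _root_.Summit.SmoothPoincare4.SmoothPoincare4.Theses.EntropyRung.NoncompactShrinkerGap)
    (h₄ : _root_.Summit.SmoothPoincare4.SmoothPoincare4.Theses.EntropyRung.CompactShrinkerGap) :
    _root_.Summit.SmoothPoincare4.SmoothPoincare4.Theses.EntropyRung.SubcylindricalRecognition := by
  intro M _ _ _ _ _ _ _ _ _ e g _ hg hR hν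
  haveI : PathConnectedSpace (Metric.sphere (0 : EuclideanSpace ℝ (Fin 5)) 1) :=
    Literature.Topology.FourManifolds.pathConnectedSpace_sphere_four
  haveI : PathConnectedSpace M :=
    Literature.Topology.FourManifolds.pathConnectedSpace_of_homotopyEquiv e
  obtain ⟨S, _, _, _, _, _, _, _, _, _, gS, _, fS, hS, hScomplete, hfS, hsol, hnorm, hSnonflat, hdens,
      hScouple⟩ := hE M g hg hR hν
  by_cases hSc : CompactSpace S
  · obtain ⟨φ, hφ, hφinj, hφimm⟩ := hScouple hSc
    obtain ⟨eSM⟩ :=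
      _root_.Summit.SmoothPoincare4.SmoothPoincare4.Theorems.SubcylindricalRecognition.AncientSphereRigidity.stub_compactModelRecognition
        S M φ hφ hφinj hφimm
    have eS4 : S ≃ₕ Metric.sphere (0 : EuclideanSpace ℝ (Fin 5)) 1 :=
      eSM.toHomeomorph.toHomotopyEquiv.trans e
    obtain ⟨eS⟩ := h₄ S eS4 gS fS hS hfS hsol hnorm hdens
    exact ⟨eSM.symm.trans eS⟩
  · haveI : NoncompactSpace S := not_compactSpace_iff.mp hSc
    have hle := h₂ S gS fS hS hScomplete hfS hsol hnorm hSnonflat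
    exact absurd hdens (not_lt.mpr hle)

/-- **The crux from the stubs and its two sibling cruxes** — RUNG via the leaf: concludes
`EntropyRung.SubcylindricalRecognition` BY NAME. [cite: Bamler2020Structure, §2.7 Thm 2.40; §2.10 Thm 2.46] -/
theorem SubcylindricalRecognition_of
    (h₂ : _root_.Summit.SmoothPoincare4.SmoothPoincare4.Theses.EntropyRung.NoncompactShrinkerGap)
    (h₄ : _root_.Summit.SmoothPoincare4.SmoothPoincare4.Theses.EntropyRung.CompactShrinkerGap) :
    _root_.Summit.SmoothPoincare4.SmoothPoincare4.Theses.EntropyRung.SubcylindricalRecognition :=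
  subcylindricalRecognition_of_leaves ShrinkerEmerges_of h₂ h₄

end Summit.SmoothPoincare4.SmoothPoincare4.Cruxes.SubcylindricalRecognition.ShrinkerEmergence

end
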